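import Summits.BirchSwinnertonDyer.Rank1Residual.Additive.X3BranchKummerLayerCubeAtThreeTable
import HarnessLib

/-!
# X3, the DEGENERATE rows, class-level count: the LOCAL CUBE CONDITION AT `3` for an ARBITRARY
# multiplicative BASIS FAMILY — a cube root of `a` fixed by the decomposition-group elements fixing
# the family, from a congruence `a·D³ = 1 + 9T` (cell `bsd-eis`, seat `bsd-eis-x3` gen 9; brick U2 of
# x3-MEMO-11; the basis-family form of gen 8's `X3BranchKummerLayerCubeAtThreeTable.lean`, whose
# family is the power basis `θ^k`; route K1 `AdditiveBranchIMC`, crux `GordTwoRankZeroOffCaseOne` —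
# supports only)

HONEST FRAMING (`run/shared/lean/pub/bsd-eis/README.md` §4): THEOREMS ONLY (no `def`, no named fact,
no `sorry`); nothing is booked; no label, tier or count of record moves.

## Why

The class-level U-side count (x3-MEMO-11) runs over the `S`-units of an ABSTRACT layer `ℚ_n` whose
ring of integers is given by an integral basis `(b_k)` with structure constants
`b_i b_j = Σ_k μ_{kij} b_k` (Mathlib `NumberField.RingOfIntegers.basis`), not by a power basis of an
explicit `θ`. The local input of `X3Branch.pow_card_le_natCard_residualQuotSelmer_of_trivialLine_of_family`
— for every conjugate `τ a` a cube root fixed by `I_{v₃} ∩ ker κ` — is supplied by a CONGRUENCE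
`a·D³ = 1 + 9T` with `D`, `T` in the `ℤ`-span of the family (then `τ a · (τD)³ = 1 + 9 τT` for every
`τ`, the span being `Γ_ℚ`-stable), exactly as gen 7/8's cube certificates, via the same `3`-adic Banach
contraction (`KummerLayerClasses.exists_fixedPoint_cubeEq_table`, reused verbatim).

## What

* §1 `sum_mul_sum_eq_family`, `exists_cube_eq_of_family` — gen 8's §2 with `T^k` replaced by any family
  `B : Fin n → L`, `B_i B_j = Σ_k μ_{kij} B_k`: `(1 + 3 Σ_k φ(s_k) B_k)³ = 1 + 9 Σ_k t_k B_k` for a suitable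
  `s ∈ ℤ₃ⁿ`, along any `φ : ℤ₃ → L`.
* §2 `exists_cubeRoot_smul_eq_self_of_decomp_family` — in `ℚ̄`: for `b : Fin n → ℚ̄` with
  `b_i b_j = Σ_k μ_{kij} b_k` and `t ∈ ℤⁿ`, some cube root of `1 + 9 Σ_k t_k b_k` is fixed by every `σ ∈ D_{v₃}`
  fixing all `b_k` (root matching through the tree's `ι : ℚ̄ → \bar{ℚ_v}` as gen 6/7/8).
* §3 `exists_goodRoot_of_congruence` — if `a·d³ = 1 + 9 Σ_k t_k b_k` with `d ≠ 0` fixed by the same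
  `σ`'s, then `a` has a cube root fixed by them.
References: [Cassels1986] Ch. 4 Lemma 3.1 (method); [SerreLocalFields1979] Ch. II §4 Prop. 8;
[NeukirchANT1999] Ch. II (9.6).
-/

set_option autoImplicit false

noncomputable section

open scoped Classical NumberField

namespace Summit.BirchSwinnertonDyer.Rank1Residual.Additive

namespace KummerLayerClasses

open NumberField IsDedekindDomain Field Metric Finset
  Literature.NumberTheory.GaloisRepresentations
  Literature.NumberTheory.EllipticCurves
  Literature.NumberTheory.EllipticCurves.GreenbergSelmer

/-! ### §1 Transport along `ℤ₃ → L` for a multiplicative family -/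

section Transport

variable {n : ℕ}

/-- Products of two family sums: `(Σ_i a_i B_i)(Σ_j c_j B_j) = Σ_k (Σ_{ij} μ_{kij} a_i c_j) B_k` when
`B_i B_j = Σ_k μ_{kij} B_k`. [folklore] -/
theorem sum_mul_sum_eq_family {L : Type*} [CommRing L] (μ : Fin n → Fin n → Fin n → ℤ) (B : Fin n → L)
    (hB : ∀ i j : Fin n, B i * B j = ∑ k, (μ k i j : L) * B k) (a c : Fin n → L) :
    (∑ i, a i * B i) * (∑ j, c j * B j) = ∑ k, (∑ i, ∑ j, (μ k i j : L) * a i * c j) * B k := by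
  calc (∑ i, a i * B i) * (∑ j, c j * B j)
      = ∑ i, ∑ j, a i * c j * (B i * B j) := by
        rw [Finset.sum_mul]
        refine Finset.sum_congr rfl fun i _ ↦ ?_
        rw [Finset.mul_sum]
        exact Finset.sum_congr rfl fun j _ ↦ by ring
    _ = ∑ i, ∑ j, ∑ k, (μ k i j : L) * a i * c j * B k := by
        refine Finset.sum_congr rfl fun i _ ↦ Finset.sum_congr rfl fun j _ ↦ ?_
        rw [hB, Finset.mul_sum]
        exact Finset.sum_congr rfl fun k _ ↦ by ring
    _ = ∑ i, ∑ k, ∑ j, (μ k i j : L) * a i * c j * B k :=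
        Finset.sum_congr rfl fun i _ ↦ Finset.sum_comm
    _ = ∑ k, ∑ i, ∑ j, (μ k i j : L) * a i * c j * B k := Finset.sum_comm
    _ = ∑ k, (∑ i, ∑ j, (μ k i j : L) * a i * c j) * B k := by
        refine Finset.sum_congr rfl fun k _ ↦ ?_
        rw [Finset.sum_mul]
        exact Finset.sum_congr rfl fun i _ ↦ by rw [Finset.sum_mul]

/-- **`1 + 9 Σ_k t_k B_k` is a cube in any `ℤ₃`-algebra with a family `B` obeying the table**: with
`s ∈ ℤ₃ⁿ` from `exists_fixedPoint_cubeEq_table` pushed along `φ : ℤ₃ → L`,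
`(1 + 3 Σ_k φ(s_k) B_k)³ = 1 + 9 Σ_k t_k B_k`. [cite: SerreLocalFields1979, Ch. II §4 Prop. 8 (method)] -/
theorem exists_cube_eq_of_family {L : Type*} [CommRing L] (φ : ℤ_[3] →+* L)
    (μ : Fin n → Fin n → Fin n → ℤ) (B : Fin n → L)
    (hB : ∀ i j : Fin n, B i * B j = ∑ k, (μ k i j : L) * B k) (t : Fin n → ℤ) :
    ∃ s : Fin n → ℤ_[3], (1 + 3 * ∑ k, φ (s k) * B k) ^ 3 = 1 + 9 * ∑ k, (t k : L) * B k := by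
  obtain ⟨s, hs⟩ := exists_fixedPoint_cubeEq_table μ (fun k ↦ (t k : ℤ_[3]))
  refine ⟨s, ?_⟩
  set S : L := ∑ k, φ (s k) * B k with hSdef
  have hS2 : S * S = ∑ k, φ (∑ i, ∑ j, (μ k i j : ℤ_[3]) * s i * s j) * B k := by
    rw [hSdef, sum_mul_sum_eq_family μ B hB]
    refine Finset.sum_congr rfl fun k _ ↦ ?_
    congr 1
    simp only [map_sum, map_mul, map_intCast]
  have hS3 : S * S * S = ∑ k, φ (∑ i, ∑ j, (μ k i j : ℤ_[3]) *
      (∑ i', ∑ j', (μ i i' j' : ℤ_[3]) * s i' * s j') * s j) * B k := by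
    rw [hS2, hSdef, sum_mul_sum_eq_family μ B hB]
    refine Finset.sum_congr rfl fun k _ ↦ ?_
    congr 1
    simp only [map_sum, map_mul, map_intCast]
  have hsum : S + 3 * (S * S) + 3 * (S * S * S) = ∑ k, (t k : L) * B k := by
    rw [hS3, hS2, hSdef, Finset.mul_sum, Finset.mul_sum, ← Finset.sum_add_distrib,
      ← Finset.sum_add_distrib]
    refine Finset.sum_congr rfl fun k _ ↦ ?_
    have e := congrArg φ (hs k)
    rw [map_intCast] at e
    rw [← e]
    simp only [map_add, map_mul, map_ofNat]
    ring
  calc (1 + 3 * S) ^ 3 = 1 + 9 * (S + 3 * (S * S) + 3 * (S * S * S)) := by ring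
    _ = 1 + 9 * ∑ k, (t k : L) * B k := by rw [hsum]

end Transport

/-! ### §2 Back to `ℚ̄`: a cube root fixed by the decomposition group elements fixing the family -/

section Decomp

variable {n : ℕ}

/-- **The local condition at `3` for a multiplicative family.** `b : Fin n → ℚ̄` with
`b_i b_j = Σ_k μ_{kij} b_k`, `t ∈ ℤⁿ`, `v` the place of `ℚ` at `3`: some cube root `β'` of
`1 + 9 Σ_k t_k b_k` in `ℚ̄` is fixed by every `σ ∈ D_v` fixing all `b_k` (§1 along
`ℤ₃ → ℚ₃ ≃ ℚ_v → \bar{ℚ_v}`, root matching through `ι : ℚ̄ → \bar{ℚ_v}`).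
[cite: NeukirchANT1999, Ch. II (9.6)] [cite: Cassels1986, Ch. 4 Lemma 3.1] -/
theorem exists_cubeRoot_smul_eq_self_of_decomp_family {b : Fin n → AlgebraicClosure ℚ}
    (μ : Fin n → Fin n → Fin n → ℤ)
    (hb : ∀ i j : Fin n, b i * b j = ∑ k, (μ k i j : AlgebraicClosure ℚ) * b k)
    (t : Fin n → ℤ) :
    ∃ β' : AlgebraicClosure ℚ,
      β' ^ 3 = 1 + 9 * ∑ k, (t k : AlgebraicClosure ℚ) * b k ∧
      ∀ σ ∈ decomp ((Rat.HeightOneSpectrum.primesEquiv (R := 𝓞 ℚ)).symm ⟨3, Nat.prime_three⟩),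
        (∀ k, σ • b k = b k) → σ • β' = β' := by
  haveI : Fact (Nat.Prime 3) := ⟨Nat.prime_three⟩
  set v := (Rat.HeightOneSpectrum.primesEquiv (R := 𝓞 ℚ)).symm ⟨3, Nat.prime_three⟩ with hv
  set ι := absClosureEmbedding ℚ (v.adicCompletion ℚ) with hι
  set a : AlgebraicClosure ℚ := 1 + 9 * ∑ k, (t k : AlgebraicClosure ℚ) * b k with ha
  let e : ℚ_[3] ≃ₐ[ℚ] v.adicCompletion ℚ := (Padic.adicCompletionEquiv (𝓞 ℚ) ⟨3, Nat.prime_three⟩).toAlgEquiv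
  let φ : ℤ_[3] →+* AlgebraicClosure (v.adicCompletion ℚ) :=
    (algebraMap (v.adicCompletion ℚ) (AlgebraicClosure (v.adicCompletion ℚ))).comp
      (e.toAlgHom.toRingHom.comp PadicInt.Coe.ringHom)
  have hφ : ∀ z : ℤ_[3],
      φ z = algebraMap (v.adicCompletion ℚ) (AlgebraicClosure (v.adicCompletion ℚ)) (e (z : ℚ_[3])) :=
    fun z ↦ rfl
  -- the table for `ι b`
  have hT : ∀ i j : Fin n, ι (b i) * ι (b j) =
      ∑ k, (μ k i j : AlgebraicClosure (v.adicCompletion ℚ)) * ι (b k) := by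
    intro i j
    have h := congrArg ι (hb i j)
    simpa [map_mul, map_sum, map_intCast] using h
  obtain ⟨s, hcube⟩ := exists_cube_eq_of_family φ μ (fun k ↦ ι (b k)) hT t
  set c : AlgebraicClosure (v.adicCompletion ℚ) := 1 + 3 * ∑ k, φ (s k) * ι (b k) with hcdef
  have hιa : ι a = 1 + 9 * ∑ k, (t k : AlgebraicClosure (v.adicCompletion ℚ)) * ι (b k) := by
    simp [ha, map_mul, map_sum, map_ofNat, map_intCast]
  -- `c` is fixed by the automorphisms of `\bar{ℚ_v}/ℚ_v` fixing every `ι b_k`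
  have hcfix : ∀ τ : absoluteGaloisGroup (v.adicCompletion ℚ), (∀ k, τ • ι (b k) = ι (b k)) →
      τ • c = c := by
    intro τ hτ
    have hu : ∀ z : ℤ_[3], absoluteGaloisGroup.toAlgEquiv _ τ (φ z) = φ z := fun z ↦ by
      rw [hφ]; exact AlgEquiv.commutes _ _
    have hτ' : ∀ k, absoluteGaloisGroup.toAlgEquiv _ τ (ι (b k)) = ι (b k) := fun k ↦ by
      rw [← absoluteGaloisGroup.smul_def]; exact hτ k
    rw [absoluteGaloisGroup.smul_def, hcdef]
    simp only [map_add, map_mul, map_one, map_ofNat, map_sum, hτ', hu]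
  -- a cube root in `ℚ̄`
  obtain ⟨β, hβ⟩ := IsAlgClosed.exists_pow_nat_eq a (by norm_num : 0 < 3)
  by_cases hc0 : c = 0
  · have ha0 : a = 0 := by
      have e0 : ι a = ι 0 := by
        rw [hιa, ← hcube, hc0, map_zero]; ring
      exact ι.injective e0
    refine ⟨0, ?_, fun σ _ _ ↦ smul_zero σ⟩
    rw [ha0]; norm_num
  · obtain ⟨ζ, hζ⟩ := HasEnoughRootsOfUnity.exists_primitiveRoot (AlgebraicClosure ℚ) 3
    have hιβ : ι β ^ 3 = c ^ 3 := by rw [← map_pow, hβ, hιa, hcube]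
    have hζ' : IsPrimitiveRoot (ι ζ) 3 := hζ.map_of_injective ι.injective
    obtain ⟨j, hj, hζj⟩ := hζ'.eq_pow_of_pow_eq_one (ξ := ι β / c)
      (by rw [div_pow, hιβ, div_self (pow_ne_zero _ hc0)])
    have hιβ' : ι (ζ ^ (3 - j) * β) = c := by
      rw [map_mul, map_pow]
      have e' : ι β = ι ζ ^ j * c := by rw [hζj, div_mul_cancel₀ _ hc0]
      rw [e', ← mul_assoc, ← pow_add, Nat.sub_add_cancel hj.le, hζ'.pow_eq_one, one_mul]
    refine ⟨ζ ^ (3 - j) * β, ?_, fun σ hσ hσb ↦ ?_⟩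
    · rw [mul_pow, ← pow_mul, mul_comm (3 - j), pow_mul, hζ.pow_eq_one, one_pow, one_mul, hβ]
    · obtain ⟨τ, rfl⟩ := hσ
      have hτT : ∀ k, τ • ι (b k) = ι (b k) := fun k ↦ by
        rw [← absGaloisRestrict_apply_smul]
        exact congrArg ι (hσb k)
      have key : ι (absGaloisRestrict ℚ (v.adicCompletion ℚ) τ • (ζ ^ (3 - j) * β)) =
          ι (ζ ^ (3 - j) * β) := by
        rw [absGaloisRestrict_apply_smul, hιβ', hcfix τ hτT]
      exact ι.injective key

/-! ### §3 Good roots from a congruence `a·d³ = 1 + 9T` -/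

/-- **A cube root of `a` fixed by `D_{v₃} ∩ Stab(b)` from a congruence `a·d³ = 1 + 9 Σ_k t_k b_k`**
with `d ≠ 0` fixed by the same elements (e.g. `a`, `d`, `T` in the ring of integers of a layer with
integral basis `b`). [cite: Cassels1986, Ch. 4 Lemma 3.1] [cite: NeukirchANT1999, Ch. II (9.6)] -/
theorem exists_goodRoot_of_congruence {b : Fin n → AlgebraicClosure ℚ}
    (μ : Fin n → Fin n → Fin n → ℤ)
    (hb : ∀ i j : Fin n, b i * b j = ∑ k, (μ k i j : AlgebraicClosure ℚ) * b k)
    {a d : AlgebraicClosure ℚ} (hd0 : d ≠ 0) (t : Fin n → ℤ)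
    (hcong : a * d ^ 3 = 1 + 9 * ∑ k, (t k : AlgebraicClosure ℚ) * b k)
    (hdfix : ∀ σ ∈ decomp ((Rat.HeightOneSpectrum.primesEquiv (R := 𝓞 ℚ)).symm ⟨3, Nat.prime_three⟩),
      (∀ k, σ • b k = b k) → σ • d = d) :
    ∃ β : AlgebraicClosure ℚ, β ^ 3 = a ∧
      ∀ σ ∈ decomp ((Rat.HeightOneSpectrum.primesEquiv (R := 𝓞 ℚ)).symm ⟨3, Nat.prime_three⟩),
        (∀ k, σ • b k = b k) → σ • β = β := by
  obtain ⟨β', hβ', hfix⟩ := exists_cubeRoot_smul_eq_self_of_decomp_family μ hb t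
  refine ⟨β' / d, ?_, fun σ hσ hσb ↦ ?_⟩
  · rw [div_pow, hβ', ← hcong, mul_div_assoc, div_self (pow_ne_zero _ hd0), mul_one]
  · rw [absoluteGaloisGroup.smul_def, map_div₀, ← absoluteGaloisGroup.smul_def,
      ← absoluteGaloisGroup.smul_def, hfix σ hσ hσb, hdfix σ hσ hσb]

end Decomp

end KummerLayerClasses

end Summit.BirchSwinnertonDyer.Rank1Residual.Additive

end
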